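import Mathlib
import Literature.Analysis.ODE.SchrodingerODE
import Literature.Analysis.ODE.InverseSquareParticular
import HarnessLib

/-!
# The true `t`-polynomial chains: perturbing the exact inverse-square chains `Σ tⁱ c_i z^{γ−2i}`

Analysis/ODE support file (everything proved, no definitions). Fix `n`, a continuous potential `P`
with `P z = n(n+1)/z² + q z` beyond `B ≥ 1`, `|q z| ≤ ε z^{-5/2}` there, and a fundamental pair
`U, V` (Wronskian `1`) with the recessive/dominant bounds of order `n` beyond `B` and the
quantitative recessiveness `|U − z⁻ⁿ| ≤ K_U ε z^{-n-1/2}`, `|U' + n z^{-n-1}| ≤ K_U ε z^{-n-3/2}`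
(`InverseSquareRecessive/Dominant.lean`). For the exact potential `n(n+1)/z²`, every datum
`z^{γ₀}` with `γ₀ = 2j − n` (`2j ≤ n`) generates a TERMINATING chain
`b_i = c_i z^{γ₀ − 2i}` (`b_i'' − n(n+1)z⁻²b_i = μ_i b_{i+1}`, `b_j ∝ z⁻ⁿ`, `b_{j+1} = 0`) for any
coefficients `μ_i ≠ 0` — these are the coefficients of the non-radiative `t`-polynomial solutions of
the exact equation. `exists_true_chain` builds, for the TRUE potential, functions `a_0, …, a_j`
(`a_{j+1} = 0`) with

  `a_i'' = P a_i + μ_i a_{i+1}` on `(B, ∞)`,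
  `|a_i − c_i z^{γ₀−2i}| ≤ K ε z^{γ₀−2i−1/2}`,
  `|a_i' − c_i (γ₀−2i) z^{γ₀−2i−1}| ≤ K ε z^{γ₀−2i−3/2}`

(`z ≥ B`), by downward induction: `a_j = c_j U`, `a_i = b_i + e_i` with `e_i` the particular
solution
of `e'' = Pe + r_i`, `r_i = μ_i(a_{i+1} − b_{i+1}) + q b_i` (`InverseSquareParticular.lean`). Hence
`Σ_i tⁱ-type a_i` are true non-radiative solutions `O(ε)`-close to the exact kernel. Route
PhotonSphereChannels, `FixedModeChannels`, far side (stmt-FinalStateConjecture-10048). Folklore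
(perturbation of regular-singular asymptotics, Hartman Ch. XI §9).
-/

noncomputable section

namespace Literature.Analysis.ODE

open MeasureTheory Set Filter Topology Real

variable {P q U V : ℝ → ℝ} {B cU cU' KU ε : ℝ} {n : ℕ}

/-- `z ↦ c z^γ` solves the exact chain equation: `(c z^γ)'' − (n(n+1)/z²)(c z^γ)
= c (γ(γ−1) − n(n+1)) z^{γ−2}` (`z > 0`), in `HasDerivAt` form. [folklore] -/
theorem hasDerivAt_monomial_chain (c γ : ℝ) {z : ℝ} (hz : 0 < z) :
    HasDerivAt (fun z : ℝ => c * z ^ γ) (c * γ * z ^ (γ - 1)) z ∧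
      HasDerivAt (fun z : ℝ => c * γ * z ^ (γ - 1)) (c * γ * (γ - 1) * z ^ (γ - 2)) z := by
  constructor
  · have h := (Real.hasDerivAt_rpow_const (p := γ) (Or.inl hz.ne')).const_mul c
    refine h.congr_deriv ?_; ring
  · have h := (Real.hasDerivAt_rpow_const (p := γ - 1) (Or.inl hz.ne')).const_mul (c * γ)
    refine h.congr_deriv ?_
    rw [show γ - 1 - 1 = γ - 2 by ring]; ring

/-- **The residual of one chain step**: with `A ≈ c' z^{γ−2}` (previous level) and
`b = c (max z 1)^γ`, the residual `r = μ(A − c'(max z 1)^{γ−2}) + q b` is continuous and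
`|r z| ≤ ε(|μ|K + |c|) z^{γ−5/2}` for `z ≥ B`. [folklore] -/
theorem true_chain_residual (hB : 1 ≤ B) (hq : Continuous q)
    (hqb : ∀ z, B ≤ z → |q z| ≤ ε * z ^ (-(5 : ℝ) / 2)) {A : ℝ → ℝ} (hAc : Continuous A)
    {c c' γ μ K : ℝ}
    (hAb : ∀ z, B ≤ z → |A z - c' * z ^ (γ - 2)| ≤ K * ε * z ^ (γ - 2 - 1 / 2)) :
    Continuous (fun z => μ * (A z - c' * (max z 1) ^ (γ - 2)) + q z * (c * (max z 1) ^ γ)) ∧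
      ∀ z, B ≤ z → |μ * (A z - c' * (max z 1) ^ (γ - 2)) + q z * (c * (max z 1) ^ γ)|
        ≤ ε * (|μ| * K + |c|) * z ^ (γ - 5 / 2) := by
  have hmaxc : Continuous fun z : ℝ => max z 1 := continuous_id.max continuous_const
  have hrpc : ∀ p : ℝ, Continuous fun z : ℝ => (max z 1) ^ p := fun p =>
    hmaxc.rpow_const fun z => Or.inl (by positivity)
  refine ⟨(continuous_const.mul (hAc.sub (continuous_const.mul (hrpc _)))).add
    (hq.mul (continuous_const.mul (hrpc _))), fun z hz => ?_⟩
  have hz0 : 0 < z := by linarith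
  have hz1 : 1 ≤ z := hB.trans hz
  rw [max_eq_left hz1]
  have e1 : |μ * (A z - c' * z ^ (γ - 2))| ≤ |μ| * K * ε * z ^ (γ - 5 / 2) := by
    rw [abs_mul]
    calc |μ| * |A z - c' * z ^ (γ - 2)| ≤ |μ| * (K * ε * z ^ (γ - 2 - 1 / 2)) :=
          mul_le_mul_of_nonneg_left (hAb z hz) (abs_nonneg _)
      _ = |μ| * K * ε * z ^ (γ - 5 / 2) := by rw [show γ - 2 - 1 / 2 = γ - 5 / 2 by ring]; ring
  have e2 : |q z * (c * z ^ γ)| ≤ |c| * ε * z ^ (γ - 5 / 2) := by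
    rw [abs_mul, abs_mul, abs_of_nonneg (rpow_nonneg hz0.le _)]
    calc |q z| * (|c| * z ^ γ) ≤ (ε * z ^ (-(5 : ℝ) / 2)) * (|c| * z ^ γ) :=
          mul_le_mul_of_nonneg_right (hqb z hz) (by positivity)
      _ = |c| * ε * (z ^ (-(5 : ℝ) / 2) * z ^ γ) := by ring
      _ = |c| * ε * z ^ (γ - 5 / 2) := by rw [← rpow_add hz0]; ring_nf
  calc |μ * (A z - c' * z ^ (γ - 2)) + q z * (c * z ^ γ)|
      ≤ |μ * (A z - c' * z ^ (γ - 2))| + |q z * (c * z ^ γ)| := abs_add_le _ _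
    _ ≤ |μ| * K * ε * z ^ (γ - 5 / 2) + |c| * ε * z ^ (γ - 5 / 2) := add_le_add e1 e2
    _ = ε * (|μ| * K + |c|) * z ^ (γ - 5 / 2) := by ring

/-- **Freezing the particular solution below `B`**: with `m = max z B`,
`ec z = −U(m)∫_B^m V r − V(m)(∫_B^∞ U r − ∫_B^m U r)` is continuous on `ℝ` and agrees with
`e z = −U(z)∫_B^z V r − V(z)∫_z^∞ U r` for `z ≥ B`. [folklore] -/
theorem true_chain_frozen (hU : IsSchrodingerSol P U) (hV : IsSchrodingerSol P V) {r : ℝ → ℝ}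
    (hrc : Continuous r) (hUri : IntegrableOn (fun s => U s * r s) (Ioi B)) :
    Continuous (fun z => -U (max z B) * (∫ s in B..(max z B), V s * r s)
        - V (max z B) * ((∫ s in Ioi B, U s * r s) - ∫ s in B..(max z B), U s * r s)) ∧
      ∀ z, B ≤ z → -U (max z B) * (∫ s in B..(max z B), V s * r s)
          - V (max z B) * ((∫ s in Ioi B, U s * r s) - ∫ s in B..(max z B), U s * r s)
        = -U z * (∫ s in B..z, V s * r s) - V z * ∫ s in Ioi z, U s * r s := by
  have hmB : Continuous fun z : ℝ => max z B := continuous_id.max continuous_const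
  have h1 : Continuous fun z : ℝ => ∫ s in B..(max z B), V s * r s :=
    (intervalIntegral.continuous_primitive (μ := volume)
      (fun a b => (hV.continuous.mul hrc).intervalIntegrable a b) B).comp hmB
  have h2 : Continuous fun z : ℝ => ∫ s in B..(max z B), U s * r s :=
    (intervalIntegral.continuous_primitive (μ := volume)
      (fun a b => (hU.continuous.mul hrc).intervalIntegrable a b) B).comp hmB
  refine ⟨(((hU.continuous.comp hmB).neg).mul h1).sub
    ((hV.continuous.comp hmB).mul (continuous_const.sub h2)), fun z hz => ?_⟩
  have hsplit : (∫ s in Ioi z, U s * r s) = (∫ s in Ioi B, U s * r s) - ∫ s in B..z, U s * r s := by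
    rw [← Ioc_union_Ioi_eq_Ioi hz, setIntegral_union (Ioc_disjoint_Ioi le_rfl) measurableSet_Ioi
      (hUri.mono_set Ioc_subset_Ioi_self) (hUri.mono_set (Ioi_subset_Ioi hz)),
      intervalIntegral.integral_of_le hz]
    ring
  simp only [max_eq_left hz, hsplit]

section
variable (hU : IsSchrodingerSol P U) (hV : IsSchrodingerSol P V)
  (hW : ∀ z, U z * deriv V z - deriv U z * V z = 1) (hB : 1 ≤ B) (hcU : 0 ≤ cU) (hcU' : 0 ≤ cU')
  (hε : 0 ≤ ε)
  (hUb : ∀ z, B ≤ z → |U z| ≤ cU * z ^ (-(n : ℝ)))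
  (hU'b : ∀ z, B ≤ z → |deriv U z| ≤ cU' * z ^ (-(n : ℝ) - 1))
  (hVb : ∀ z, B ≤ z → |V z| ≤ 6 * z ^ ((n : ℝ) + 1))
  (hV'b : ∀ z, B ≤ z → |deriv V z| ≤ 5 * z ^ (n : ℝ))
  (hq : Continuous q) (hPq : ∀ z, B ≤ z → P z = (n : ℝ) * (n + 1) / z ^ 2 + q z)
  (hqb : ∀ z, B ≤ z → |q z| ≤ ε * z ^ (-(5 : ℝ) / 2))
include hU hV hW hB hcU hcU' hε hUb hU'b hVb hV'b hq hPq hqb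

/-- **One step down the true chain.** Given the previous level `A ≈ c' z^{γ−2}` and the exact
coefficient relation `μ c' = c(γ(γ−1) − n(n+1))`, `γ ≤ 0`, `−n + 2 ≤ γ`, there is a continuous
`a ≈ c z^γ` with `a'' = P a + μ A` on `(B, ∞)`. [folklore] -/
theorem true_chain_step {A : ℝ → ℝ} (hAc : Continuous A) {c c' γ μ K : ℝ} (hK : 0 ≤ K)
    (hμc : μ * c' = c * (γ * (γ - 1) - n * (n + 1))) (hγ0 : γ ≤ 0) (hγn : -(n : ℝ) + 2 ≤ γ)
    (hAb : ∀ z, B ≤ z → |A z - c' * z ^ (γ - 2)| ≤ K * ε * z ^ (γ - 2 - 1 / 2)) :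
    ∃ a a' : ℝ → ℝ, Continuous a ∧
      (∀ z, B < z → HasDerivAt a (a' z) z ∧ HasDerivAt a' (P z * a z + μ * A z) z) ∧
      (∀ z, B ≤ z → |a z - c * z ^ γ| ≤ 8 * cU * (|μ| * K + |c|) * ε * z ^ (γ - 1 / 2) ∧
        |a' z - c * γ * z ^ (γ - 1)|
          ≤ (4 * cU' + 4 * cU) * (|μ| * K + |c|) * ε * z ^ (γ - 3 / 2)) := by
  have hB0 : 0 < B := by linarith
  obtain ⟨hrc, hrb⟩ := true_chain_residual (c := c) (c' := c') (γ := γ) (μ := μ) hB hq hqb hAc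
    hAb
  set r : ℝ → ℝ := fun z => μ * (A z - c' * (max z 1) ^ (γ - 2)) + q z * (c * (max z 1) ^ γ) with hr
  set κ : ℝ := γ - 5 / 2 with hκ
  have hκ1 : κ < n - 1 := by simp only [hκ]; linarith
  have hκ2 : -(n : ℝ) - 2 < κ := by simp only [hκ]; linarith
  set R₀ : ℝ := ε * (|μ| * K + |c|) with hR₀
  have hR₀0 : 0 ≤ R₀ := by positivity
  have hrb' : ∀ z, B ≤ z → |r z| ≤ R₀ * z ^ κ := fun z hz => by
    simp only [hr, hR₀, hκ]; exact hrb z hz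
  obtain ⟨hed, heb⟩ := inverseSquare_particular hU hV hW hB hcU hcU' hUb hU'b hVb hV'b hrc
    hR₀0 hκ1 hκ2 hrb'
  -- integrability of `U r` on `Ioi B` (for the frozen version)
  have hUri : IntegrableOn (fun s => U s * r s) (Ioi B) := by
    refine Integrable.mono' ((integrableOn_Ioi_rpow_of_lt (by linarith : κ - n < -1) hB0).const_mul
      (cU * R₀)) (hU.continuous.mul hrc).aestronglyMeasurable
      ((ae_restrict_iff' measurableSet_Ioi).2 (ae_of_all _ fun s hs => ?_))
    have hs : B ≤ s := le_of_lt hs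
    have hs0 : 0 < s := by linarith
    rw [Real.norm_eq_abs, abs_mul]
    calc |U s| * |r s| ≤ (cU * s ^ (-(n : ℝ))) * (R₀ * s ^ κ) :=
          mul_le_mul (hUb s hs) (hrb' s hs) (abs_nonneg _) (by positivity)
      _ = cU * R₀ * s ^ (κ - n) := by
          rw [show κ - n = -(n : ℝ) + κ by ring, rpow_add hs0 (-(n : ℝ)) κ]; ring
  obtain ⟨hecc, hece0⟩ := true_chain_frozen (B := B) hU hV hrc hUri
  set ec : ℝ → ℝ := fun z => -U (max z B) * (∫ s in B..(max z B), V s * r s)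
    - V (max z B) * ((∫ s in Ioi B, U s * r s) - ∫ s in B..(max z B), U s * r s) with hec
  set e : ℝ → ℝ := fun z => -U z * (∫ s in B..z, V s * r s) - V z * ∫ s in Ioi z, U s * r s with he
  have hece : ∀ z, B ≤ z → ec z = e z := fun z hz => by
    simp only [hec, he]; exact hece0 z hz
  set e' : ℝ → ℝ := fun z => -deriv U z * (∫ s in B..z, V s * r s)
    - deriv V z * ∫ s in Ioi z, U s * r s with he'
  set a : ℝ → ℝ := fun z => c * (max z 1) ^ γ + ec z with ha
  set a' : ℝ → ℝ := fun z => c * γ * (max z 1) ^ (γ - 1) + e' z with ha'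
  have hmaxc : Continuous fun z : ℝ => max z 1 := continuous_id.max continuous_const
  have hac : Continuous a :=
    (continuous_const.mul (hmaxc.rpow_const fun z => Or.inl (by positivity))).add hecc
  refine ⟨a, a', hac, fun z hz => ?_, fun z hz => ?_⟩
  · have hz0 : 0 < z := by linarith
    have hz1 : 1 < z := by linarith
    obtain ⟨hm1, hm2⟩ := hasDerivAt_monomial_chain c γ hz0
    obtain ⟨he1, he2⟩ := hed z hz
    have hloc : a =ᶠ[𝓝 z] fun y => c * y ^ γ + e y := by
      filter_upwards [Ioi_mem_nhds hz] with y hy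
      have hy1 : (1 : ℝ) ≤ y := by have := Set.mem_Ioi.1 hy; linarith
      show c * (max y 1) ^ γ + ec y = c * y ^ γ + e y
      rw [max_eq_left hy1, hece y (le_of_lt hy)]
    have hloc' : a' =ᶠ[𝓝 z] fun y => c * γ * y ^ (γ - 1) + e' y := by
      filter_upwards [Ioi_mem_nhds hz1] with y hy
      show c * γ * (max y 1) ^ (γ - 1) + e' y = c * γ * y ^ (γ - 1) + e' y
      rw [max_eq_left (le_of_lt hy)]
    have haz : a z = c * z ^ γ + e z := by
      show c * (max z 1) ^ γ + ec z = _; rw [max_eq_left hz1.le, hece z hz.le]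
    have ha'z : a' z = c * γ * z ^ (γ - 1) + e' z := by
      show c * γ * (max z 1) ^ (γ - 1) + e' z = _; rw [max_eq_left hz1.le]
    constructor
    · rw [ha'z]
      exact (hm1.add he1).congr_of_eventuallyEq hloc
    · have h := (hm2.add he2).congr_of_eventuallyEq hloc'
      refine h.congr_deriv ?_
      rw [haz, hPq z hz.le]
      have hr_z : r z = μ * (A z - c' * z ^ (γ - 2)) + q z * (c * z ^ γ) := by
        show μ * (A z - c' * (max z 1) ^ (γ - 2)) + q z * (c * (max z 1) ^ γ) = _
        rw [max_eq_left hz1.le]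
      rw [hr_z]
      have hz2 : z ^ (γ - 2) = z ^ γ / z ^ 2 := by rw [rpow_sub hz0, rpow_two]
      have hcγ : c * γ * (γ - 1) = μ * c' + c * (n * (n + 1)) := by linarith [hμc]
      rw [hz2, hcγ]
      field_simp
      ring
  · have hz0 : 0 < z := by linarith
    have hz1 : 1 ≤ z := by linarith
    obtain ⟨b1, b2⟩ := heb z hz
    have hCe1 : 6 * cU * (1 / (n - 1 - κ) + 1 / (κ + n + 2)) ≤ 8 * cU := by
      have hk1 : 0 < κ + n + 2 := by simp only [hκ]; linarith
      have hk2 : 0 < n - 1 - κ := by simp only [hκ]; linarith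
      have h1 : 1 / (n - 1 - κ) ≤ 2 / 3 := by
        rw [div_le_div_iff₀ hk2 (by norm_num)]; simp only [hκ]; linarith
      have h2 : 1 / (κ + n + 2) ≤ 2 / 3 := by
        rw [div_le_div_iff₀ hk1 (by norm_num)]; simp only [hκ]; linarith
      nlinarith [h1, h2, hcU]
    have hCe2 : 6 * cU' / (κ + n + 2) + 5 * cU / (n - 1 - κ) ≤ 4 * cU' + 4 * cU := by
      have hk1 : 0 < κ + n + 2 := by simp only [hκ]; linarith
      have hk2 : 0 < n - 1 - κ := by simp only [hκ]; linarith
      have h1 : 6 * cU' / (κ + n + 2) ≤ 4 * cU' := by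
        rw [div_le_iff₀ hk1]; simp only [hκ]; nlinarith [hcU']
      have h2 : 5 * cU / (n - 1 - κ) ≤ 4 * cU := by
        rw [div_le_iff₀ hk2]; simp only [hκ]; nlinarith [hcU]
      linarith
    have hx1 : z ^ (κ + 2) = z ^ (γ - 1 / 2) := by simp only [hκ]; ring_nf
    have hx2 : z ^ (κ + 1) = z ^ (γ - 3 / 2) := by simp only [hκ]; ring_nf
    have hzp1 : 0 ≤ z ^ (κ + 2) := rpow_nonneg hz0.le _
    have hzp2 : 0 ≤ z ^ (κ + 1) := rpow_nonneg hz0.le _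
    constructor
    · have : a z - c * z ^ γ = e z := by
        show c * (max z 1) ^ γ + ec z - c * z ^ γ = _
        rw [max_eq_left hz1, hece z hz]; ring
      rw [this]
      calc |e z| ≤ (6 * cU * (1 / (n - 1 - κ) + 1 / (κ + n + 2))) * R₀ * z ^ (κ + 2) := b1
        _ ≤ (8 * cU) * R₀ * z ^ (κ + 2) := by gcongr
        _ = 8 * cU * (|μ| * K + |c|) * ε * z ^ (γ - 1 / 2) := by rw [hx1, hR₀]; ring
    · have : a' z - c * γ * z ^ (γ - 1) = e' z := by
        show c * γ * (max z 1) ^ (γ - 1) + e' z - c * γ * z ^ (γ - 1) = _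
        rw [max_eq_left hz1]; ring
      rw [this]
      calc |e' z| ≤ (6 * cU' / (κ + n + 2) + 5 * cU / (n - 1 - κ)) * R₀ * z ^ (κ + 1) := b2
        _ ≤ (4 * cU' + 4 * cU) * R₀ * z ^ (κ + 1) := by gcongr
        _ = (4 * cU' + 4 * cU) * (|μ| * K + |c|) * ε * z ^ (γ - 3 / 2) := by rw [hx2, hR₀]; ring

end

/-- **The true chains**, with a closeness constant `K = K(n, j, μ, c_U, c_U', K_U)` UNIFORM in the
potential. See the module docstring. [folklore] -/
theorem exists_true_chain (n : ℕ) {μ : ℕ → ℝ} (hμ : ∀ i, μ i ≠ 0) {j : ℕ} (hj : 2 * j ≤ n)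
    {cU cU' KU : ℝ} (hcU : 0 ≤ cU) (hcU' : 0 ≤ cU') (hKU : 0 ≤ KU) :
    ∃ K : ℝ, 0 ≤ K ∧ ∀ {P q U V : ℝ → ℝ} {B ε : ℝ},
      IsSchrodingerSol P U → IsSchrodingerSol P V →
      (∀ z, U z * deriv V z - deriv U z * V z = 1) → 1 ≤ B → 0 ≤ ε →
      (∀ z, B ≤ z → |U z| ≤ cU * z ^ (-(n : ℝ))) →
      (∀ z, B ≤ z → |deriv U z| ≤ cU' * z ^ (-(n : ℝ) - 1)) →
      (∀ z, B ≤ z → |V z| ≤ 6 * z ^ ((n : ℝ) + 1)) →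
      (∀ z, B ≤ z → |deriv V z| ≤ 5 * z ^ (n : ℝ)) →
      Continuous q → (∀ z, B ≤ z → P z = (n : ℝ) * (n + 1) / z ^ 2 + q z) →
      (∀ z, B ≤ z → |q z| ≤ ε * z ^ (-(5 : ℝ) / 2)) →
      (∀ z, B ≤ z → |U z - z ^ (-(n : ℝ))| ≤ KU * ε * z ^ (-(n : ℝ) - 1 / 2)) →
      (∀ z, B ≤ z → |deriv U z + n * z ^ (-(n : ℝ) - 1)| ≤ KU * ε * z ^ (-(n : ℝ) - 3 / 2)) →
    ∃ (a a' : ℕ → ℝ → ℝ) (c : ℕ → ℝ), c 0 = 1 ∧ (∀ z, a (j + 1) z = 0) ∧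
      (∀ i, i ≤ j → Continuous (a i)) ∧
      (∀ i, i ≤ j → ∀ z, B < z →
        HasDerivAt (a i) (a' i z) z ∧ HasDerivAt (a' i) (P z * a i z + μ i * a (i + 1) z) z) ∧
      (∀ i, i ≤ j → ∀ z, B ≤ z →
        |a i z - c i * z ^ ((2 * j : ℝ) - n - 2 * i)|
            ≤ K * ε * z ^ ((2 * j : ℝ) - n - 2 * i - 1 / 2) ∧
        |a' i z - c i * ((2 * j : ℝ) - n - 2 * i) * z ^ ((2 * j : ℝ) - n - 2 * i - 1)|
          ≤ K * ε * z ^ ((2 * j : ℝ) - n - 2 * i - 3 / 2)) ∧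
      (∀ i, i ≤ j → |c i| ≤ K) := by
  -- the exact coefficients (depend on `n, j, μ` only)
  set γ : ℕ → ℝ := fun i => (2 * j : ℝ) - n - 2 * i with hγ
  set c : ℕ → ℝ := fun i => Nat.rec 1 (fun i ci => ci * (γ i * (γ i - 1) - n * (n + 1)) / μ i) i
    with hc
  have hc0 : c 0 = 1 := rfl
  have hcsucc : ∀ i, c (i + 1) = c i * (γ i * (γ i - 1) - n * (n + 1)) / μ i := fun i => rfl
  have hμc : ∀ i, μ i * c (i + 1) = c i * (γ i * (γ i - 1) - n * (n + 1)) := fun i => by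
    rw [hcsucc]; field_simp [hμ i]
  set Kc : ℝ := ∑ i ∈ Finset.range (j + 2), |c i| with hKc
  have hKc0 : 0 ≤ Kc := Finset.sum_nonneg fun i _ => abs_nonneg _
  have hcK : ∀ i, i ≤ j + 1 → |c i| ≤ Kc := fun i hi =>
    Finset.single_le_sum (f := fun i => |c i|) (fun i _ => abs_nonneg _)
      (Finset.mem_range.2 (Nat.lt_succ_of_le hi))
  have hγj : γ j = -(n : ℝ) := by simp only [hγ]; ring
  -- the explicit closeness constants, level by level (depend on `n, j, μ, cU, cU', KU` only)
  set Ks : ℕ → ℝ := fun k => Nat.rec (Kc * KU) (fun k Kk => max Kk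
    (max (8 * cU * (|μ (j - (k + 1))| * Kk + Kc)) ((4 * cU' + 4 * cU) * (|μ (j - (k + 1))| * Kk + Kc))))
    k with hKs
  have hKs0 : Ks 0 = Kc * KU := rfl
  have hKsucc : ∀ k, Ks (k + 1) = max (Ks k) (max (8 * cU * (|μ (j - (k + 1))| * Ks k + Kc))
      ((4 * cU' + 4 * cU) * (|μ (j - (k + 1))| * Ks k + Kc))) := fun k => rfl
  have hKsnn : ∀ k, 0 ≤ Ks k := fun k => by
    induction k with
    | zero => rw [hKs0]; positivity
    | succ k ih => rw [hKsucc]; exact ih.trans (le_max_left _ _)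
  refine ⟨max (Ks j) Kc, le_max_of_le_right hKc0, ?_⟩
  intro P q U V B ε hU hV hW hB hε hUb hU'b hVb hV'b hq hPq hqb hUrec hU'rec
  have hB0 : 0 < B := by linarith
  -- the invariant, by induction on the number `k` of levels below the top
  have main : ∀ k, k ≤ j → ∃ (a a' : ℕ → ℝ → ℝ), (∀ z, a (j + 1) z = 0) ∧
      ∀ i, j - k ≤ i → i ≤ j → Continuous (a i) ∧
        (∀ z, B < z → HasDerivAt (a i) (a' i z) z ∧
          HasDerivAt (a' i) (P z * a i z + μ i * a (i + 1) z) z) ∧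
        (∀ z, B ≤ z → |a i z - c i * z ^ (γ i)| ≤ Ks k * ε * z ^ (γ i - 1 / 2) ∧
          |a' i z - c i * γ i * z ^ (γ i - 1)| ≤ Ks k * ε * z ^ (γ i - 3 / 2)) := by
    intro k
    induction k with
    | zero =>
      intro _
      refine ⟨Function.update (fun _ _ => (0 : ℝ)) j (fun z => c j * U z),
        Function.update (fun _ _ => (0 : ℝ)) j (fun z => c j * deriv U z),
        fun z => by simp, ?_⟩
      intro i hi1 hi2
      have hij : i = j := le_antisymm hi2 (by simpa using hi1)
      subst hij
      simp only [Function.update_self, Function.update_of_ne (Nat.succ_ne_self i)]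
      refine ⟨hU.continuous.const_mul _, fun z hz => ⟨(hU.hasDerivAt z).const_mul _, ?_⟩,
        fun z hz => ⟨?_, ?_⟩⟩
      · have h := (hU.hasDerivAt_deriv z).const_mul (c i)
        refine h.congr_deriv ?_
        simp only [mul_zero, add_zero]; ring
      · rw [hγj, ← mul_sub, abs_mul, hKs0]
        calc |c i| * |U z - z ^ (-(n : ℝ))| ≤ Kc * (KU * ε * z ^ (-(n : ℝ) - 1 / 2)) :=
              mul_le_mul (hcK i (Nat.le_succ i)) (hUrec z hz) (abs_nonneg _) hKc0
          _ = Kc * KU * ε * z ^ (-(n : ℝ) - 1 / 2) := by ring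
      · rw [hγj, hKs0]
        have e : c i * deriv U z - c i * -(n : ℝ) * z ^ (-(n : ℝ) - 1)
            = c i * (deriv U z + n * z ^ (-(n : ℝ) - 1)) := by ring
        rw [e, abs_mul]
        calc |c i| * |deriv U z + n * z ^ (-(n : ℝ) - 1)|
            ≤ Kc * (KU * ε * z ^ (-(n : ℝ) - 3 / 2)) :=
              mul_le_mul (hcK i (Nat.le_succ i)) (hU'rec z hz) (abs_nonneg _) hKc0
          _ = Kc * KU * ε * z ^ (-(n : ℝ) - 3 / 2) := by ring
    | succ k ih =>
      intro hk
      obtain ⟨a, a', htop, hinv⟩ := ih (Nat.le_of_succ_le hk)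
      obtain ⟨i₀, hi₀⟩ : ∃ i₀ : ℕ, i₀ = j - (k + 1) := ⟨_, rfl⟩
      have hi₀j : i₀ < j := by omega
      obtain ⟨hAc, -, hAb⟩ := hinv (i₀ + 1) (by omega) (by omega)
      have hγs : γ (i₀ + 1) = γ i₀ - 2 := by simp only [hγ]; push_cast; ring
      have hγle : γ i₀ ≤ 0 := by
        have h1 : (2 * j : ℝ) ≤ n := by exact_mod_cast hj
        have h2 : (0 : ℝ) ≤ i₀ := Nat.cast_nonneg _
        show (2 * j : ℝ) - n - 2 * i₀ ≤ 0; linarith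
      have hγge : -(n : ℝ) + 2 ≤ γ i₀ := by
        have h1 : (i₀ : ℝ) + 1 ≤ j := by exact_mod_cast hi₀j
        show -(n : ℝ) + 2 ≤ (2 * j : ℝ) - n - 2 * i₀; linarith
      have hAb' : ∀ z, B ≤ z → |a (i₀ + 1) z - c (i₀ + 1) * z ^ (γ i₀ - 2)|
          ≤ Ks k * ε * z ^ (γ i₀ - 2 - 1 / 2) := by
        intro z hz; have h := (hAb z hz).1; rwa [hγs] at h
      obtain ⟨anew, anew', hacont, hader, habd⟩ := true_chain_step hU hV hW hB hcU hcU' hε hUb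
        hU'b hVb hV'b hq hPq hqb hAc (hKsnn k) (hμc i₀) hγle hγge hAb'
      set L : ℝ := |μ i₀| * Ks k + |c i₀| with hL
      have hLle : L ≤ |μ i₀| * Ks k + Kc := by
        simp only [hL]; linarith [hcK i₀ (by omega)]
      have hKle : Ks k ≤ Ks (k + 1) := by rw [hKsucc]; exact le_max_left _ _
      have hK1 : 8 * cU * L ≤ Ks (k + 1) := by
        rw [hKsucc, ← hi₀]
        exact (mul_le_mul_of_nonneg_left hLle (by positivity)).trans
          ((le_max_left _ _).trans (le_max_right _ _))
      have hK2 : (4 * cU' + 4 * cU) * L ≤ Ks (k + 1) := by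
        rw [hKsucc, ← hi₀]
        exact (mul_le_mul_of_nonneg_left hLle (by positivity)).trans
          ((le_max_right _ _).trans (le_max_right _ _))
      have hKn := hKsnn (k + 1)
      refine ⟨Function.update a i₀ anew, Function.update a' i₀ anew', fun z => ?_,
        fun i hi1 hi2 => ?_⟩
      · rw [Function.update_of_ne (by omega : j + 1 ≠ i₀)]; exact htop z
      rcases Nat.lt_or_ge i₀ i with hlt | hge
      · -- old levels
        have hne : i ≠ i₀ := by omega
        have hne' : i + 1 ≠ i₀ := by omega
        simp only [Function.update_of_ne hne, Function.update_of_ne hne']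
        obtain ⟨h1, h2, h3⟩ := hinv i (by omega) hi2
        refine ⟨h1, h2, fun z hz => ?_⟩
        obtain ⟨b1, b2⟩ := h3 z hz
        have hz0 : 0 < z := by linarith
        exact ⟨b1.trans (by gcongr), b2.trans (by gcongr)⟩
      · -- the new level `i = i₀`
        have hii : i = i₀ := by omega
        subst hii
        simp only [Function.update_self, Function.update_of_ne (Nat.succ_ne_self i)]
        refine ⟨hacont, hader, fun z hz => ?_⟩
        obtain ⟨b1, b2⟩ := habd z hz
        have hz0 : 0 < z := by linarith
        exact ⟨b1.trans (by gcongr), b2.trans (by gcongr)⟩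
  -- conclusion
  obtain ⟨a, a', htop, hinv⟩ := main j le_rfl
  refine ⟨a, a', c, hc0, htop, fun i hi => (hinv i (by omega) hi).1,
    fun i hi z hz => (hinv i (by omega) hi).2.1 z hz, fun i hi z hz => ?_,
    fun i hi => (hcK i (by omega)).trans (le_max_right _ _)⟩
  obtain ⟨b1, b2⟩ := (hinv i (by omega) hi).2.2 z hz
  have hz0 : 0 < z := by linarith
  have hKK : Ks j ≤ max (Ks j) Kc := le_max_left _ _
  have hKn : 0 ≤ max (Ks j) Kc := le_max_of_le_right hKc0
  exact ⟨b1.trans (by gcongr), b2.trans (by gcongr)⟩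

end Literature.Analysis.ODE
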